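import Summits.AnomalousDissipation.AnomalousDissipation.Theses.TwoAndHalfD
import Summits.AnomalousDissipation.AnomalousDissipation.Theorems.ScalarAnomalySteadySourceFormal.Negative.ForcedClassicalWeak
import Summits.AnomalousDissipation.AnomalousDissipation.Theorems.ScalarAnomalySteadySourceFormal.Negative.LoadBearing
import Literature.Analysis.FluidPDE.PassiveScalarForced
import Literature.Analysis.FluidPDE.PassiveScalarWellPosedness
import Literature.Analysis.FluidPDE.LongTimeAverageNonneg
import Literature.Analysis.FluidPDE.TimeAverageMeasureBasic

/-!
# Line `isotypic-source-selection` for crux `TwoAndHalfD.ScalarAnomalySteadySourceFormal`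
# (stmt-AnomalousDissipation-0448) — checked skeleton (crux-plan, round 1, 2026-08-16)

Idea card: `Cruxes/ScalarAnomalySteadySourceFormal/Ideas/isotypic-source-selection.md` (ideator 1;
triage r1-1 / r1-2 / r1-3: pass ×3, carrier of the merge with `odd-point-reflection-sector`).
Line card: `Lines/isotypic-source-selection.md`.

THE LINE. The crux asks for ONE steady smooth source `h` whose sourced scalar keeps bounded variance
(clause (v)) and an `O(1)` dissipation floor (clause (vi)) along a vanishing-viscosity ladder of
steadily forced planar Leray–Hopf flows at Prandtl number one. At `Pr = 1` the vorticity solves the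
same sourced equation with source `curl g`, and its variance (the enstrophy) MUST diverge along any
witness ladder; by Banach–Steinhaus the admissible sources of a witness flow are a meagre subspace —
`h` cannot be generic, it must sit in an exactly propagator-invariant sector that misses every slow
(trapped) mode. The only exact such sector a planar torus flow offers for free is a CHARACTER SECTOR
of a point group of the dynamics: run Navier–Stokes in the fixed space of the point reflection
`P : x ↦ -x` (equivariant force and data ⇒ equivariant velocities, `v(t,-x) = -v(t,x)`; zero momentum
and the four pinned stagnation points `2p = 0` come free) and take `h` ODD, `h(-x) = -h(x)` (triage
r1-3: the `P`-odd isotypic component, e.g. `sin 2πx₁`, vanishes at all four pins and is `L²`-orthogonal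
to every `P`-even field — vorticity, stream function, `|v|²`, `curl g`, `F(ψ, ω)` — for all times).
The sourced scalar then lives in the odd sector for ever (S3), so ONLY THE ODD-SECTOR PROPAGATOR has
to be fast: a `j`- and start-time-uniform HALF-LIFE `τ` of the unforced propagator on odd data
(triage r1-1's sharpening: the sector-restricted `HasUniformScalarDissipationTime`; its unrestricted
form is false for every bounded-energy NS family, triage r1-1 (★)) gives the variance clause by the
halving iteration `‖θ((k+1)τ)‖ ≤ ½‖θ(kτ)‖ + τ‖h‖` (S4), for GENUINE (classical, unique) solutions
provided by global well-posedness (S2) — no junk door of the weak class is touched (Disproof §2).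
The open dynamics is isolated in ONE existential stub (S1): a `P`-equivariant bounded-energy
Leray–Hopf ladder whose odd sector has a uniform half-life AND which feeds the chosen odd `h` at an
`O(1)` rate (the floor is carried, not derived: odd sources are invisible to — hence protected from,
but also starved by — every `P`-symmetric coherent structure; see S1's docstring).

STUBS (stated over tree vocabulary only — no local definition enters a stub — so that each can be
landed verbatim as `Theorems/ScalarAnomalySteadySourceFormal/<Stub>.lean --supports
stmt-AnomalousDissipation-0448`; copy the `open` lines below):
* S1 `stub_oddSectorMixingFamily`   — THE CRUX OF THE LINE (K1 ⊕ K2 of the card + the input floor):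
                                      `∃` odd-symmetric smooth bounded-energy LH ladder with a uniform
                                      odd-sector half-life `τ` and a dissipation floor `ε` for one odd
                                      `h`. OPEN.                                                  [XL]
* S2 `stub_globalClassicalSourced`  — global (`[0,∞)`) classical well-posedness of
                                      `∂ₜθ + u·∇θ = κΔθ + s` for smooth drift/source/datum (gluing of
                                      the PROVED finite-window fact
                                      `Torus.exists_unique_isClassicalScalarTransportForcedOn_holds`). [M−]
* S3 `stub_oddSectorInvariance`     — odd drift-equivariance + odd source + odd datum ⇒ the classical
                                      sourced solution stays odd (covariance + uniqueness `eq_on_Icc`). [M]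
* S4 `stub_varianceFromHalfLife`    — odd-sector half-life `τ` ⇒ `sup_t ‖θ(t)‖² ≤ 16τ²‖h‖²` for the
                                      odd sourced solution from the zero datum (halving iteration;
                                      linearity, restart, energy estimates).                      [M]
Composition (kernel-checked; no `sorry` outside the four `stub_*`): `oddSectorWitness` proves the
TRANSFER TARGET `C⁺` (the crux inside the odd sector, with CLASSICAL sourced solutions from the zero
datum and a POINTWISE variance bound; its statement is the type of that theorem) from S1–S4, and
`ScalarAnomalySteadySourceFormal_of : TwoAndHalfD.ScalarAnomalySteadySourceFormal` (the crux BY NAME,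
no hypotheses) is the forgetful transfer `C⁺ ⇒ crux`: classical ⇒ weak by the disprover's LANDED
`Negative.isWeakScalarTransportForcedOn_of_classical` (`Theorems/…/Negative/ForcedClassicalWeak.lean`),
zero datum in `L²`, pointwise ⇒ `limsup` mean by `longTimeAvgSup_le_of_forall_le`.

DISPROOF USED (`Cruxes/ScalarAnomalySteadySourceFormal/Disproof.lean`, cdisprove gen 1, @2026-08-16T02:27Z;
its certified copies are LANDED under `Theorems/ScalarAnomalySteadySourceFormal/Negative/` —
`KillShape`, `ForcedClassicalWeak`, `ForcedToolkit`, `ForcedModes`, `HeatProfile`, `LoadBearing`,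
`RestFlowSteady`, `RestFlowNoGo` — and the two this skeleton leans on are IMPORTED above, so every
stub is checked in their presence; no theorem is named `_false_without_…`, the load-bearing lemmas of
`Negative.LoadBearing` play that role):
* `Negative.cruxWithoutVarianceBound_holds` ((v) is load-bearing) — honoured: (v) is EARNED at S4
  from the half-life of S1, for genuine classical solutions (no `longTimeAvgSup` junk: the bound is
  pointwise in time first); `Negative.varianceUnbounded_heatFamily` is exactly what S1's half-life
  clause forbids (heat half-life of `sin 2πx₁` is `log 2/(4π²ν_j) → ∞`).
* `Negative.cruxIndexedSource_holds` (ONE fixed `h` is load-bearing) — honoured: `h` is bound BEFORE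
  `j` in S1 and is the same function in S3/S4 and in the floor.
* `Negative.cruxWithoutFloor_holds` ((vi) must be earned) — the line does NOT derive (vi); it is the
  last conjunct of S1, stated for the classical sourced solution from the zero datum, with its own
  failure mode (odd sources are starved by symmetric condensates). Honest, and the first target for
  refuters.
* `Negative.not_cruxRestFlow` (`RestFlowNoGo`, refuted strengthening) — respected automatically: at
  rest the odd-sector half-life is the heat half-life `→ ∞`, so no S1-witness is at rest; likewise
  Disproof §5(b) constant drifts (an odd velocity field has zero mean), §5(c) single-shell `g` and
  §5(e) uniformly Lipschitz ladders (a `ν`-uniform `H¹` or Lipschitz bound renormalises /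
  Batchelor-logs the odd sector too: no uniform half-life) — S1 forces `Z_j → ∞` and
  `‖∇v_j‖_∞ ≳ log(1/ν_j)/τ`, consistent with §5. No stub is an instance of a landed Negative lemma:
  S1 keeps (v)'s substitute (c), ONE fixed `h`, the floor, and a genuinely moving flow.
* `Negative.isWeakScalarTransportForcedOn_of_classical` (`ForcedClassicalWeak`, landed) — USED in
  `ScalarAnomalySteadySourceFormal_of`.
`ledger negatives --problem AnomalousDissipation` (13037 / 2984 / 2859 / 2979: 3-D `∀`-data ceilings
refuted by Galilean drift / constant data): none is an instance of any stub (S1 is `∃` and picks odd,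
zero-momentum data; S2–S4 are linear scalar lemmas).
-/

namespace Summit.AnomalousDissipation.AnomalousDissipation.Cruxes.ScalarAnomalySteadySourceFormal.IsotypicSourceSelection

open MeasureTheory Filter Topology
open scoped ENNReal NNReal
open Literature.Analysis.FunctionSpaces Literature.Analysis.FluidPDE

set_option linter.dupNamespace false

/-! ## S1 — the odd-sector mixing family (K1 ⊕ K2 of the card, plus the input floor): OPEN -/

/-- **S1 `stub_oddSectorMixingFamily` — the crux of the line.** There exist a smooth divergence-free
mean-zero steady planar force `g`, a smooth mean-zero source `h` that is ODD under the point
reflection (`h(-x) = -h(x)`; design: `h = sin 2πx₁`, the `P`-odd isotypic component inside `Fix(C₄)`,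
triage r1-3), viscosities `ν_j ↓ 0`, data `v₀_j` and global Leray–Hopf solutions `v_j` of the planar
Navier–Stokes equations forced by `g`, a half-life `τ > 0` and a floor `ε > 0`, such that:
(a) `v_j` is jointly smooth on `[0,∞) × T²` with divergence-free slices (choose smooth equivariant
data: planar NS is globally classical, and classical global solutions are global Leray–Hopf —
`IsClassicalNSSolutionOn.isGlobalLerayHopf`, `TorusClassicalLerayHopfProofs`) and EQUIVARIANT under
`P` for all `t ≥ 0`,
`v_j(t,-x) = -v_j(t,x)` (the dynamics is run in `Fix(P)`: `g` odd, data odd, uniqueness — Lions–Prodi,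
`lions_prodi_uniqueness_torus2_holds`; zero momentum and pinned stagnation points at the four
half-lattice points come free); (b) `ν`-uniformly bounded `limsup`-mean energy; (c) ODD-SECTOR
HALF-LIFE, uniform in `j` and in the start time `s ≥ 0`: every classical solution `φ` of the
UNFORCED equation `∂ₜφ + v_j·∇φ = ν_jΔφ` on `[s, s+τ]` whose datum `φ(s)` is odd has
`‖φ(s+τ)‖²_{L²} ≤ ¼‖φ(s)‖²` (the sector-restricted `HasUniformScalarDissipationTime` of
`SketchIdeator2`, triage r1-1's sharpening; for classical solutions, which are unique given the datum,
so no junk); (d) INPUT FLOOR for the one odd `h`: the classical solution of the SOURCED equation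
`∂ₜθ + v_j·∇θ = ν_jΔθ + h` from the zero datum has `limsup`-mean dissipation `⟨ν_j‖∇θ_j‖²⟩ ≥ ε`
(equivalently, by the energy identity and S4, mean input `⟨(h, θ_j)⟩ ≥ ε`).
WHY IT MIGHT BE TRUE: (c) asks the flow to mix only the odd sector — every certified slow mode of a
`Pr = 1` witness (vorticity, stream function, `P`-symmetric reservoirs / condensate cells centred at
pins, `F(ψ,ω)`) is `P`-even and invisible; what (c) still forbids are odd slow modes: `P`-swapped pairs
of off-centre islands with `∮h ≠ 0` (triage r1-1/r1-2's explicit 4-cycles for `cos 6πx`-type skeletons)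
and odd almost-invariant lobes (K2 of the card: "slowness is confined to the trivial sector"); the
mixing itself must come from time dependence at rate `≳ log(1/ν_j)/τ` in `‖∇v_j‖_∞` (Batchelor
logarithm, Disproof §5(e), BARRIER-NOTES B1 — allowed by the budgets `ν⟨‖∇v‖²⟩ ≤ ‖g‖√E`,
`ν⟨‖Δv‖²⟩ ≤ ‖Δg‖_∞√E`), e.g. by the periodic cellular mixers of card `budgeted-mixer-template` or the
pinned-reservoir vortex gas, run inside `Fix(P)` (uniformity in `s` is natural for (quasi-)periodic
witnesses; for generic turbulence with intermittent quiet episodes the first reshape is an `s`-averaged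
half-life). WHY IT MIGHT FAIL: (i) odd slow modes are forced in bounded-energy `Fix(P)` dynamics
(swapped island pairs around the shell-`b` skeleton cells; Babiano–Boffetta–Provenzale–Vulpiani 1994);
(ii) uniformity in `s` over an infinite horizon excludes intermittency; (iii) the FLOOR: odd sources
have zero mean on every `P`-invariant closed streamline, so a cleanly condensing ladder (Gallet–Young
dipole at the pins) feeds `h` only through its fluctuations — protection from trapping is also
starvation of input, and `⟨(h,θ_j)⟩` may tend to `0` with the fluctuation level. DESIGN CONSTRAINTS
honoured automatically: rest flow, constant drifts, single-shell `g`, `ν`-uniformly Lipschitz ladders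
all violate (c) (Disproof §5–§6, SINGLE_SHELL_2HALFD.md), so (c) forces `Z_j → ∞` with `ν_jZ_j → 0`
and two forcing shells; no junk: Leray–Hopf energies are bounded in time at fixed `ν_j` (absorbing
ball), so (b) is an honest mean, and the floor (d) is junk-proof (Disproof §2). LEAD'S FIRST RESHAPE
(foreseen): once the ladder is an explicit construction `mixer j`, (c) and (d) become two separate
theorems about a named object (source-free odd mixing / input floor for `h`).
Sources: arXiv:1911.11014 Thm 1.3, Rem 1.6–1.7; arXiv:1310.2986 Thm 1.1;
arXiv:2304.05374 Thm 1 (optimal `|log ν|` dissipation time exists kinematically); arXiv:1707.05525;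
GalletYoung2013; Disproof §4–§6. Size XL (hardest stub; the lead splits (c)/(d) when building). -/
theorem stub_oddSectorMixingFamily :
    ∃ (g : UnitAddTorus (Fin 2) → EuclideanSpace ℝ (Fin 2)) (h : UnitAddTorus (Fin 2) → ℝ) (ν : ℕ → ℝ)
      (v₀ : ℕ → UnitAddTorus (Fin 2) → EuclideanSpace ℝ (Fin 2)) (v : ℕ → ℝ → UnitAddTorus (Fin 2) → EuclideanSpace ℝ (Fin 2)) (τ ε : ℝ),
      Torus.IsSmooth g ∧ Torus.IsDivFree g ∧ Torus.HasZeroMean g ∧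
      Torus.IsSmooth h ∧ Torus.HasZeroMean h ∧ (∀ x, h (-x) = -h x) ∧
      0 < τ ∧ 0 < ε ∧ (∀ j, 0 < ν j) ∧ Tendsto ν atTop (𝓝 0) ∧
      (∀ j, Torus.IsGlobalLerayHopf (ν j) (fun _ => g) (v₀ j) (v j)) ∧
      (∀ j, Torus.IsSmoothSpaceTimeOn (Set.Ici 0) (v j)) ∧
      (∀ j (t : ℝ), 0 ≤ t → Torus.IsDivFree (v j t)) ∧
      (∀ j (t : ℝ), 0 ≤ t → ∀ x, v j t (-x) = -v j t x) ∧
      (∃ E : ℝ, ∀ j, meanEnergy (v j) ≤ E) ∧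
      (∀ j (s : ℝ), 0 ≤ s → ∀ φ : ℝ → UnitAddTorus (Fin 2) → ℝ,
        Torus.IsClassicalScalarTransportOn (Set.Icc s (s + τ)) (ν j) (v j) φ →
        (∀ x, φ s (-x) = -φ s x) →
        Torus.scalarL2Sq (φ (s + τ)) ≤ 4⁻¹ * Torus.scalarL2Sq (φ s)) ∧
      (∀ j (θ : ℝ → UnitAddTorus (Fin 2) → ℝ),
        Torus.IsClassicalScalarTransportForcedOn (Set.Ici 0) (ν j) (v j) (fun _ => h) θ →
        θ 0 = (fun _ => 0) →
        ε ≤ longTimeAvgSup (fun t => ν j * (Torus.eScalarGradNormSq (θ t)).toReal)) := by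
  sorry

/-! ## S2 — global classical well-posedness of the sourced advection–diffusion equation -/

/-- **S2 `stub_globalClassicalSourced` — global classical solutions on `[0, ∞)`.** For `κ > 0`, a
drift `u` jointly smooth on `[0,∞) × T²` with divergence-free slices, a source `s` jointly smooth on
`[0,∞) × T²` and a smooth datum `θ₀`, the forced advection–diffusion equation
`∂ₜθ + u·∇θ = κΔθ + s` has a classical solution on `[0, ∞)`
(`Torus.IsClassicalScalarTransportForcedOn (Set.Ici 0)`) with `θ(0) = θ₀`. WHY TRUE: the
finite-window fact `Torus.exists_unique_isClassicalScalarTransportForcedOn` is PROVED in tree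
(`exists_unique_isClassicalScalarTransportForcedOn_holds`, `PassiveScalarWellPosednessProofs`:
Fourier–Picard existence on `[0,T]`, energy uniqueness `IsClassicalScalarTransportForcedOn.eq_on_Icc`);
glue the solutions on `[0,n]`, `n = 1, 2, …` (they agree on overlaps by uniqueness), joint smoothness
on `Ici 0 ×ˢ univ` is local (`contDiffOn` of the glued lift agrees with the `[0,n+1]`-solution near
every point of `[0,n] × T²`), and `timeDerivWithin (Ici 0)` agrees with `timeDerivWithin (Icc 0 T)`
on `[0,T)` (unique differentiability; cf. `IsClassicalScalarTransportOn.restrict`). Uniqueness on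
`[0,∞)` is then `eq_on_Icc` window by window (not needed by the composition). Used by the
composition with `s = fun _ => h`, `θ₀ = 0`, and inside the proofs of S3/S4 (restarts, after the time
shift `u(s+·)`). Size M− (Lean glue of a proved fact; no mathematics is open). -/
theorem stub_globalClassicalSourced :
    ∀ (κ : ℝ), 0 < κ →
      ∀ (u : ℝ → UnitAddTorus (Fin 2) → EuclideanSpace ℝ (Fin 2)) (s : ℝ → UnitAddTorus (Fin 2) → ℝ) (θ₀ : UnitAddTorus (Fin 2) → ℝ),
        Torus.IsSmoothSpaceTimeOn (Set.Ici 0) u → (∀ t : ℝ, 0 ≤ t → Torus.IsDivFree (u t)) →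
        Torus.IsSmoothSpaceTimeOn (Set.Ici 0) s → Torus.IsSmooth θ₀ →
        ∃ θ : ℝ → UnitAddTorus (Fin 2) → ℝ,
          Torus.IsClassicalScalarTransportForcedOn (Set.Ici 0) κ u s θ ∧ θ 0 = θ₀ := by
  sorry

/-! ## S3 — the odd sector is exactly invariant (OddSectorInvariance of the card) -/

/-- **S3 `stub_oddSectorInvariance` — equivariant drift, odd source, odd datum ⇒ odd solution.**
For `κ > 0`, a drift with `u(t,-x) = -u(t,x)` for `t ≥ 0`, an odd steady source `h` and a classical
solution `θ` of `∂ₜθ + u·∇θ = κΔθ + h` on `[0,∞)` with odd datum `θ(0)`: `θ(t)` is odd for every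
`t ≥ 0`. WHY TRUE: `θ'(t,x) := -θ(t,-x)` is again a classical solution with the same datum — the
point reflection is a smooth group automorphism of `T²`, `∇(θ∘P)(x) = -(∇θ)(Px)`, `Δ(θ∘P) = (Δθ)∘P`,
`timeDerivWithin` commutes with the spatial precomposition, and `⟪u(t,x), -(∇θ)(t,-x)⟫ =
⟪u(t,-x), (∇θ)(t,-x)⟫` by equivariance — so `θ' = θ` on every `[0,T]` by uniqueness
(`Torus.IsClassicalScalarTransportForcedOn.eq_on_Icc`, after `IsClassicalScalarTransportOn.restrict`
from `Ici 0` to `Icc 0 T`). Tree: `FlatTorus` calculus (`gradient`, `laplacian`, `partialDeriv` under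
the linear isometry `x ↦ -x`: `Torus.IsSmooth.comp` with a continuous linear map / `TorusIntegerEndomorphism`
for `-1 ∈ GL₂(ℤ)`), `measurePreserving_neg`. Corollary (not needed here, card P1/P2): `∫θω = ∫θψ =
∫θ|v|² = 0` for all `t` (odd ⊥ even by Haar invariance of `P`). Size M. -/
theorem stub_oddSectorInvariance :
    ∀ (κ : ℝ), 0 < κ →
      ∀ (u : ℝ → UnitAddTorus (Fin 2) → EuclideanSpace ℝ (Fin 2)) (h : UnitAddTorus (Fin 2) → ℝ) (θ : ℝ → UnitAddTorus (Fin 2) → ℝ),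
        (∀ t : ℝ, 0 ≤ t → ∀ x, u t (-x) = -u t x) → (∀ x, h (-x) = -h x) →
        (∀ x, θ 0 (-x) = -θ 0 x) →
        Torus.IsClassicalScalarTransportForcedOn (Set.Ici 0) κ u (fun _ => h) θ →
        ∀ t : ℝ, 0 ≤ t → ∀ x, θ t (-x) = -θ t x := by
  sorry

/-! ## S4 — bounded variance from the odd-sector half-life (the halving iteration) -/

/-- **S4 `stub_varianceFromHalfLife` — Duhamel/halving bookkeeping.** For `κ, τ > 0`, a drift `u`
whose unforced propagator HALVES every odd classical datum over every window `[s, s+τ]`, `s ≥ 0`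
(hypothesis verbatim S1 (c)), and the classical solution `θ` of `∂ₜθ + u·∇θ = κΔθ + h` on `[0,∞)` from
the zero datum which is odd at all times `t ≥ 0` (S3): `‖θ(t)‖²_{L²} ≤ 16 τ² ‖h‖²_{L²}` for every
`t ≥ 0`. WHY TRUE (paper, half a page; constant `9` suffices): sourced energy identity
`d/dt ½‖θ‖² = -κ‖∇θ‖² + (h,θ)` ⇒ `‖θ(t)‖ ≤ ‖θ(s)‖ + (t-s)‖h‖`; at `s = kτ` restart: `θ = φ + ρ` on
`[s, s+τ]` with `φ` the classical UNFORCED solution from the odd datum `θ(s)` (exists: S2 / the tree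
fact after the time shift `u(s+·)`, which is smooth on `[0,τ]`) and `ρ := θ - φ` the classical sourced
solution from `0` (linearity, `IsClassicalScalarTransportForcedOn.sub`); the half-life gives
`‖φ(s+τ)‖ ≤ ½‖θ(s)‖`, the energy estimate `‖ρ(s+τ)‖ ≤ τ‖h‖`, hence `a_{k+1} ≤ ½a_k + τ‖h‖`,
`a_0 = 0`, so `a_k ≤ 2τ‖h‖` and `‖θ(t)‖ ≤ 3τ‖h‖` in between. Tree: `scalarL2Sq_add_scalarDissipation_holds`,
`antitoneOn_scalarL2Sq`, `hasDerivWithinAt_scalarL2Sq_holds` (unforced; the forced energy identity is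
the same computation with `∫ hθ ≤ ‖h‖‖θ‖` added — cf. Disproof §6 `forced_sub` for the weak class),
`IsClassicalScalarTransportOn.restrict(_Icc)`. This is card `lp-flux-locality-threshold` 3b /
`budgeted-mixer-template` P1 (`DissipationTimeBoundsVariance`) in its sector-restricted, junk-free
classical form (triage merge note). Size M. -/
theorem stub_varianceFromHalfLife :
    ∀ (κ τ : ℝ), 0 < κ → 0 < τ →
      ∀ (u : ℝ → UnitAddTorus (Fin 2) → EuclideanSpace ℝ (Fin 2)) (h : UnitAddTorus (Fin 2) → ℝ) (θ : ℝ → UnitAddTorus (Fin 2) → ℝ),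
        (∀ s : ℝ, 0 ≤ s → ∀ φ : ℝ → UnitAddTorus (Fin 2) → ℝ,
          Torus.IsClassicalScalarTransportOn (Set.Icc s (s + τ)) κ u φ →
          (∀ x, φ s (-x) = -φ s x) →
          Torus.scalarL2Sq (φ (s + τ)) ≤ 4⁻¹ * Torus.scalarL2Sq (φ s)) →
        (∀ t : ℝ, 0 ≤ t → ∀ x, θ t (-x) = -θ t x) →
        Torus.IsClassicalScalarTransportForcedOn (Set.Ici 0) κ u (fun _ => h) θ →
        θ 0 = (fun _ => 0) →
        ∀ t : ℝ, 0 ≤ t → Torus.scalarL2Sq (θ t) ≤ 16 * τ ^ 2 * Torus.scalarL2Sq h := by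
  sorry

/-! ## The transfer target `C⁺` and the composition (no `sorry` outside the stubs) -/

/-- A `limsup` long-time average of a nonnegative observable bounded by `B` on `[0,∞)` is `≤ B`
(honest `limsup`: the Cesàro means lie in `[0, B]`). [folklore] -/
theorem longTimeAvgSup_le_of_forall_le {f : ℝ → ℝ} {B : ℝ} (h0 : ∀ t, 0 ≤ f t)
    (hB : ∀ t, 0 ≤ t → f t ≤ B) : longTimeAvgSup f ≤ B := by
  unfold longTimeAvgSup
  refine Filter.limsup_le_of_le ?_ ?_
  · exact Filter.isCoboundedUnder_le_of_eventually_le atTop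
      ((eventually_ge_atTop (0 : ℝ)).mono fun T hT => timeMean_nonneg h0 hT)
  · refine (eventually_gt_atTop (0 : ℝ)).mono fun T hT => ?_
    have habs : |timeMean f T| ≤ B :=
      abs_timeMean_le hT fun t ht _ => by
        rw [abs_of_nonneg (h0 t)]
        exact hB t ht.le
    exact (abs_le.1 habs).2

/-- **TRANSFER TARGET `C⁺` — the crux inside the odd sector** (the card's `Transfer:`; this theorem's
TYPE is `C⁺`): the data of the crux with, in addition, `h` odd, `v_j` `P`-equivariant for `t ≥ 0`, the
scalars `θ_j` CLASSICAL global solutions of the sourced equation from the zero datum, odd for all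
`t ≥ 0`, and a POINTWISE-in-time variance bound. Why easier than the crux: the variance functional
sees only the odd-sector propagator (S4), the certified slow `P`-even modes (vorticity, stream
function, symmetric reservoirs) are invisible (S3), and every clause speaks of unique classical
objects (no junk door). PROOF from the stubs: take the family of S1; solve the sourced equation
globally and classically from the zero datum (S2); the solution stays odd (S3); the odd-sector
half-life bounds its variance pointwise (S4); the floor is S1 (d). -/
theorem oddSectorWitness :
    ∃ (g : UnitAddTorus (Fin 2) → EuclideanSpace ℝ (Fin 2)) (h : UnitAddTorus (Fin 2) → ℝ) (ν : ℕ → ℝ)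
      (v₀ : ℕ → UnitAddTorus (Fin 2) → EuclideanSpace ℝ (Fin 2))
      (v : ℕ → ℝ → UnitAddTorus (Fin 2) → EuclideanSpace ℝ (Fin 2))
      (θ : ℕ → ℝ → UnitAddTorus (Fin 2) → ℝ),
      Torus.IsSmooth g ∧ Torus.IsDivFree g ∧ Torus.HasZeroMean g ∧
      Torus.IsSmooth h ∧ Torus.HasZeroMean h ∧ (∀ x, h (-x) = -h x) ∧
      (∀ j, 0 < ν j) ∧ Tendsto ν atTop (𝓝 0) ∧
      (∀ j, Torus.IsGlobalLerayHopf (ν j) (fun _ => g) (v₀ j) (v j)) ∧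
      (∀ j (t : ℝ), 0 ≤ t → ∀ x, v j t (-x) = -v j t x) ∧
      (∀ j, Torus.IsClassicalScalarTransportForcedOn (Set.Ici 0) (ν j) (v j) (fun _ => h) (θ j)) ∧
      (∀ j, θ j 0 = fun _ => 0) ∧
      (∀ j (t : ℝ), 0 ≤ t → ∀ x, θ j t (-x) = -θ j t x) ∧
      (∃ E : ℝ, ∀ j, meanEnergy (v j) ≤ E) ∧
      (∃ V : ℝ, ∀ j (t : ℝ), 0 ≤ t → Torus.scalarL2Sq (θ j t) ≤ V) ∧
      ∃ ε : ℝ, 0 < ε ∧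
        ∀ j, ε ≤ longTimeAvgSup (fun t => ν j * (Torus.eScalarGradNormSq (θ j t)).toReal) := by
  obtain ⟨g, h, ν, v₀, v, τ, ε, hgs, hgd, hgz, hhs, hhz, hhodd, hτ, hε, hν, hν0, hLH, hsm, hdiv,
    hodd, hE, hhalf, hfloor⟩ := stub_oddSectorMixingFamily
  -- the sourced scalars: global classical solutions from the zero datum (S2)
  have hsrc : Torus.IsSmoothSpaceTimeOn (Set.Ici (0 : ℝ))
      (fun _ : ℝ => h) := Torus.isSmoothSpaceTimeOn_const hhs _
  have hzero : Torus.IsSmooth (fun _ : UnitAddTorus (Fin 2) => (0 : ℝ)) := Torus.isSmooth_const (0 : ℝ)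
  choose θ hθ hθ0 using fun j =>
    stub_globalClassicalSourced (ν j) (hν j) (v j) (fun _ => h) (fun _ => 0) (hsm j) (hdiv j) hsrc hzero
  -- the odd sector is invariant (S3)
  have hoddθ : ∀ j (t : ℝ), 0 ≤ t → ∀ x, θ j t (-x) = -θ j t x := fun j =>
    stub_oddSectorInvariance (ν j) (hν j) (v j) h (θ j) (hodd j) hhodd (fun x => by simp [hθ0 j]) (hθ j)
  -- the halving iteration (S4)
  have hvar : ∀ j (t : ℝ), 0 ≤ t → Torus.scalarL2Sq (θ j t) ≤ 16 * τ ^ 2 * Torus.scalarL2Sq h :=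
    fun j => stub_varianceFromHalfLife (ν j) τ (hν j) hτ (v j) h (θ j) (hhalf j) (hoddθ j) (hθ j) (hθ0 j)
  exact ⟨g, h, ν, v₀, v, θ, hgs, hgd, hgz, hhs, hhz, hhodd, hν, hν0, hLH, hodd, hθ, hθ0, hoddθ, hE,
    ⟨16 * τ ^ 2 * Torus.scalarL2Sq h, hvar⟩, ε, hε, fun j => hfloor j (θ j) (hθ j) (hθ0 j)⟩

/-- **The composition `ScalarAnomalySteadySourceFormal_of` = the forgetful TRANSFER `C⁺ ⇒ crux`**
(concludes the crux BY NAME, takes no hypotheses; the only `sorry`s are inside the four `stub_*`):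
classical global solutions are weak solutions of the crux's class
(`Negative.isWeakScalarTransportForcedOn_of_classical`, landed by the disprover under
`Theorems/ScalarAnomalySteadySourceFormal/Negative/ForcedClassicalWeak.lean`), the zero datum is in `L²`,
and a pointwise variance bound on `[0,∞)` bounds the `limsup` long-time mean. -/
theorem ScalarAnomalySteadySourceFormal_of :
    Summit.AnomalousDissipation.AnomalousDissipation.Theses.TwoAndHalfD.ScalarAnomalySteadySourceFormal := by
  obtain ⟨g, h, ν, v₀, v, θ, hgs, hgd, hgz, hhs, hhz, -, hν, hν0, hLH, -, hθ, hθ0, -, hE, ⟨V, hV⟩,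
    ε, hε, hfloor⟩ := oddSectorWitness
  refine ⟨g, h, hgs, hgd, hgz, hhs, hhz, ν, v₀, v, fun _ _ => 0, θ, hν, hν0, hLH,
    fun _ => memLp_const 0, fun j T _ => ?_, hE, ⟨V, fun j => ?_⟩, ε, hε, hfloor⟩
  · have hw := Summit.AnomalousDissipation.AnomalousDissipation.Theorems.ScalarAnomalySteadySourceFormal.Negative.isWeakScalarTransportForcedOn_of_classical
      (T := T) (hθ j) Set.Icc_subset_Ici_self
    rwa [hθ0 j] at hw
  · exact longTimeAvgSup_le_of_forall_le (fun t => Torus.scalarL2Sq_nonneg _) (hV j)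

end Summit.AnomalousDissipation.AnomalousDissipation.Cruxes.ScalarAnomalySteadySourceFormal.IsotypicSourceSelection
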